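import Literature.MathematicalPhysics.QuantumFieldTheory.Balaban1983to89.B9Eq3126BondTentProfile
import Literature.MathematicalPhysics.QuantumFieldTheory.Balaban1983to89.B9Eq3126BondLiftEnergy
import Literature.MathematicalPhysics.QuantumFieldTheory.Balaban1983to89.B9Eq3126GreenLetters

/-!
# `Balaban1983to89.B9Eq3126KFloorWindowedKit` — T. Bałaban, *Propagators for lattice gauge theories in a background field*, Commun. Math. Phys. **99**
# (1985) 389–434 [Balaban1985BackgroundPropagators] (3.26) p. 395, (3.10) p. 392, (3.21) p. 394, (3.79) p. 406, with [Balaban1985Averaging] (125) p. 36: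
# **THREE SMALL LETTERS FOR THE WINDOWED BACKGROUND — the energy of a test field at (3.26) for a GENERAL background is a sum of FORMS
# (`‖curl_U u‖² + ‖⟪u, Δ′(U)u⟫‖ + ‖D*_U u‖² + a‖Qu‖²`, the gauge slot a contraction), the size of the bond tent lift, and the perturbation of a
# pairing letter by a difference of averagings** — the kit of `B9Eq3126KFloorWindowedTower` (pub-balaban NE9 chain, variational `H₁`-currency)

statement-level skeleton of published theorems with citation tags; proofs where landed; nothing here is a claim about the Yang–Mills mass gap

CITATION HEADER (lean-in-tree rule).  Audit cell `pub-balaban`, sub-cell `t4`, BINDER row NE9; filed by NE9 formalisation-swarm LEAF PROVER 02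
(`b2b-balaban-t4-ne9-formalise-leaf-02`, gen 65).  Sources READ in the held text layers: [Balaban1985BackgroundPropagators]
(`paper:balaban1985-cmp99-background-propagators`, journal page = PDF page + 388) pp. 392–395, 406, 416, 420; [Balaban1985Averaging] p. 36 (125).

THE PRINT (verbatim).  [B9] (3.26) p. 395 `Δ₁(U) = Δ(U) + D₁R(U)D₁* + Q*(U)aQ(U)`; (3.10) p. 392 `Δ(U) = D*D + Δ′`; (3.21) p. 394 *«R = R(U) is an orthogonal projection»*;
p. 406, (3.79): the averaging operators are Lipschitz in the background; p. 416, Thm 3.11.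

WHY THIS FILE (cell context).  The variational letters (`B9Eq3126GreenLettersVariational`) see a background only through two FORMS of a fixed test field:
the pairing `re⟪Q(U)u, ψ⟫` and the energy `re⟪u, Δ_a(U)u⟫`.  §1 bounds the energy by four forms for ANY background (the gauge slot costs nothing: `R(U)` is a
contraction and `D* = D†`), §2 sizes the bond tent (`‖u_ψ‖ ≤ N‖ψ‖`, `N = L³(L²∕4)^{d−1}√(c₀L^d∕c₁)` — the power `L^{2d+1}` of the pairing margin), §3 moves a
pairing letter by `δ·N` when the averaging moves by `δ` in operator norm on the test field, and bounds a perturbed square by twice the two squares.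

WHAT IS PROVED (sorry-free; 0 `def`; [folklore]; nothing of [B9] asserted).
* §1 **`re_inner_laplaceALatticeK_hessOp_le`** — `re⟪u, (Δ(U) + D_U Rr D*_U + Q†aQ)u⟫ ≤ ‖η⁻¹curl_U u‖² + ‖⟪u, Δ′(U)u⟫‖ + ‖η⁻¹D*_U u‖² + a‖Qu‖²` (`hRS`, `‖Rr s‖ ≤ ‖s‖`).
* §2 **`norm_sq_tent_le`** — `‖u_ψ‖² ≤ (L³(L²∕4)^{d−1})²(c₀L^d∕c₁)‖ψ‖²`.
* §3 `pairing_perturb`, `norm_sq_le_two_mul`.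
HONEST SCOPE.  Elementary; NOT NE9, NOT the route (cell pub-balaban: NE9 NOT PRINTED ∕ NOT PROVED; «NE9 ⇐ the named binders»; spine PROVED 0∕9; rung (B)+1 on a finite
T⁴ — NOT infinite volume, NOT mass gap, NOT Clay).  HONEST DEPENDENCY (cell line): continuum YM on T⁴ ⇐ BetaPertH ∧ nine spine estimates (0/9 proved); BetaPertH ⇐
(D1) ∧ (D4) ∧ CAP+tail; G-an2-4 gates asym, D1 and NE2/3/4.  NEW file importing `B9Eq3126BondTentProfile`, `B9Eq3126BondLiftEnergy` (this lineage) and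
`B9Eq3126GreenLetters` (for the `L²` letters' imports); nothing modified.  Net new unproved facts: 0.
-/

noncomputable section

open scoped InnerProductSpace ComplexConjugate BigOperators

namespace Literature.MathematicalPhysics.QuantumFieldTheory.Balaban1983to89.B9Eq3126KFloorWindowedKit

open B9SectCLatticeCarrier (Bond shift)
open B9Eq311L2Pairing (WL2)
open B11Eq103H1Complex (SiteL2K BondL2K covDerivL2K covDivL2K laplaceALatticeK laplaceAK laplaceAK_apply adjoint_covDerivL2K)
open B9Eq310HessianOperator (adTransportW hessOp hessOp_apply principalOpK_eq_comp covCurlL2K curvOp inner_covCoCurlL2K_covCurlL2K)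

/-! ## §1 The energy of a test field at a GENERAL background: forms only -/

section Energy

variable {d : ℕ} {Pd : Fin d → ℕ} {𝔸 : Type*} [NormedRing 𝔸] [NormedAlgebra ℂ 𝔸] [StarRing 𝔸] [StarModule ℂ 𝔸]
  {W : Type*} [NormedAddCommGroup W] [InnerProductSpace ℂ W] [FiniteDimensional ℂ W] (φ : W ≃ₗ[ℂ] 𝔸)
  {c₀ : ℝ} [Fact (0 < c₀)] (η : ℝ) (U : Bond d Pd → 𝔸ˣ) (τ : 𝔸 →ₗ[ℂ] ℂ)
  {F : Type*} [NormedAddCommGroup F] [InnerProductSpace ℂ F] [FiniteDimensional ℂ F]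

/-- **THE ENERGY OF A TEST FIELD AT (3.26) FOR A GENERAL BACKGROUND — FORMS ONLY**: with mutually adjoint transporters (`hRS`), ANY contraction `Rr`
in the gauge slot and ANY averaging `Q`, for every `u` and real `a`:
`re⟪u, (Δ(U) + D_U Rr D*_U + Q†aQ)u⟫ ≤ ‖η⁻¹curl_U u‖² + ‖⟪u, Δ′(U)u⟫‖ + ‖η⁻¹D*_U u‖² + a‖Qu‖²`. [folklore]
[cite: Balaban1985BackgroundPropagators, (3.26) p.395, (3.10) p.392, (3.21) p.394] -/
theorem re_inner_laplaceALatticeK_hessOp_le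
    (hRS : ∀ (b : Bond d Pd) (v u : W), ⟪adTransportW φ U b v, u⟫_ℂ = ⟪v, adTransportW φ (fun b => (U b)⁻¹) b u⟫_ℂ)
    (Rr : SiteL2K ℂ d Pd c₀ W →ₗ[ℂ] SiteL2K ℂ d Pd c₀ W) (hRr : ∀ s, ‖Rr s‖ ≤ ‖s‖) (Q : BondL2K ℂ d Pd c₀ W →ₗ[ℂ] F) (a : ℝ)
    (u : BondL2K ℂ d Pd c₀ W) :
    RCLike.re ⟪u, laplaceALatticeK ((η : ℂ))⁻¹ (adTransportW φ U) (adTransportW φ fun b => (U b)⁻¹) (hessOp φ η U τ) Rr Q a u⟫_ℂ ≤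
      ‖covCurlL2K ℂ c₀ ((η : ℂ))⁻¹ (adTransportW φ U) u‖ ^ 2 + ‖⟪u, curvOp φ τ η U u⟫_ℂ‖ +
      ‖covDivL2K ℂ c₀ ((η : ℂ))⁻¹ (adTransportW φ fun b => (U b)⁻¹) u‖ ^ 2 + a * ‖Q u‖ ^ 2 := by
  have hc : conj (((η : ℂ))⁻¹) = ((η : ℂ))⁻¹ := by rw [map_inv₀, Complex.conj_ofReal]
  unfold laplaceALatticeK
  rw [laplaceAK_apply, inner_add_right, inner_add_right, map_add, map_add, hessOp_apply, inner_add_right, map_add]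
  have T1 : RCLike.re ⟪u, B9Eq310HessianOperator.principalOpK φ η U u⟫_ℂ = ‖covCurlL2K ℂ c₀ ((η : ℂ))⁻¹ (adTransportW φ U) u‖ ^ 2 := by
    rw [principalOpK_eq_comp, LinearMap.comp_apply, inner_covCoCurlL2K_covCurlL2K _ hc _ _ hRS, ← RCLike.ofReal_pow, RCLike.ofReal_re]
  have T1' : RCLike.re ⟪u, curvOp φ τ η U u⟫_ℂ ≤ ‖⟪u, curvOp φ τ η U u⟫_ℂ‖ := RCLike.re_le_norm _
  have T2 : RCLike.re ⟪u, covDerivL2K ℂ c₀ ((η : ℂ))⁻¹ (adTransportW φ U) (Rr (covDivL2K ℂ c₀ ((η : ℂ))⁻¹ (adTransportW φ fun b => (U b)⁻¹) u))⟫_ℂ ≤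
      ‖covDivL2K ℂ c₀ ((η : ℂ))⁻¹ (adTransportW φ fun b => (U b)⁻¹) u‖ ^ 2 := by
    rw [← LinearMap.adjoint_inner_left, adjoint_covDerivL2K _ hc _ _ hRS]
    refine (re_inner_le_norm _ _).trans ?_
    rw [sq]
    exact mul_le_mul_of_nonneg_left (hRr _) (norm_nonneg _)
  have T3 : RCLike.re ⟪u, LinearMap.adjoint Q (((a : ℝ) : ℂ) • Q u)⟫_ℂ = a * ‖Q u‖ ^ 2 := by
    rw [LinearMap.adjoint_inner_right, inner_smul_right, ← inner_self_eq_norm_sq (𝕜 := ℂ)]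
    simp only [RCLike.re_to_complex, Complex.re_ofReal_mul]
  exact add_le_add (add_le_add (add_le_add (le_of_eq T1) T1') T2) (le_of_eq T3)

end Energy

/-! ## §2 The size of the bond tent lift -/

section Size

open B4Sect5Torus (TSite)
open B9Eq319QprimeTorus (fineP offset offset_lt blockCoord)

variable {d : ℕ} (L : ℕ) [NeZero L] (m : Fin d → ℕ) {W : Type*} [NormedAddCommGroup W] [InnerProductSpace ℂ W] (c₀ c₁ : ℝ) [Fact (0 < c₀)] [Fact (0 < c₁)]

/-- **THE SIZE OF THE BOND TENT LIFT**: `‖u_ψ‖² ≤ (L³(L²∕4)^{d−1})²·(c₀L^d∕c₁)·‖ψ‖²` (each coefficient is `≤ L³·(L²∕4)^{d−1}`; block partition; weights).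
[folklore] [cite: Balaban1985Averaging, (2) p.17, (125) p.36; Balaban1985BackgroundPropagators, (3.11) p.392] -/
theorem norm_sq_tent_le (ψ : BondL2K ℂ d m c₁ W) :
    ‖(WL2.equiv ℂ (fun _ : Bond d (fineP L m) => c₀) W).symm
        (fun b => (((((offset L m b.1 b.2 : ℕ) : ℝ) ^ 2 * ((L : ℝ) - 1 - (offset L m b.1 b.2 : ℕ))) *
            ∏ ν ∈ Finset.univ.erase b.2, (((offset L m b.1 ν : ℕ) : ℝ) * ((L : ℝ) - 1 - (offset L m b.1 ν : ℕ))) : ℝ) : ℂ) •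
          WL2.equiv ℂ (fun _ : Bond d m => c₁) W ψ (blockCoord L m b.1, b.2))‖ ^ 2 ≤
      ((L : ℝ) ^ 3 * ((L : ℝ) ^ 2 / 4) ^ (d - 1)) ^ 2 * (c₀ * (L : ℝ) ^ d / c₁) * ‖ψ‖ ^ 2 := by
  have hc₀ : 0 < c₀ := Fact.out
  have hc₁ : 0 < c₁ := Fact.out
  set ψt := WL2.equiv ℂ (fun _ : Bond d m => c₁) W ψ with hψt
  set S : ℝ := (L : ℝ) ^ 3 * ((L : ℝ) ^ 2 / 4) ^ (d - 1) with hS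
  rw [WL2.norm_sq]
  have hcoef : ∀ b : Bond d (fineP L m), 0 ≤ (((offset L m b.1 b.2 : ℕ) : ℝ) ^ 2 * ((L : ℝ) - 1 - (offset L m b.1 b.2 : ℕ))) *
      ∏ ν ∈ Finset.univ.erase b.2, (((offset L m b.1 ν : ℕ) : ℝ) * ((L : ℝ) - 1 - (offset L m b.1 ν : ℕ))) ∧
      (((offset L m b.1 b.2 : ℕ) : ℝ) ^ 2 * ((L : ℝ) - 1 - (offset L m b.1 b.2 : ℕ))) *
      ∏ ν ∈ Finset.univ.erase b.2, (((offset L m b.1 ν : ℕ) : ℝ) * ((L : ℝ) - 1 - (offset L m b.1 ν : ℕ))) ≤ S := by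
    intro b
    have hq0 := B9Eq3126BondTentProfile.qprof_nonneg (offset_lt L m b.1 b.2)
    have hqle := B9Eq3126BondTentProfile.qprof_le (offset_lt L m b.1 b.2)
    have hP0 : 0 ≤ ∏ ν ∈ Finset.univ.erase b.2, (((offset L m b.1 ν : ℕ) : ℝ) * ((L : ℝ) - 1 - (offset L m b.1 ν : ℕ))) :=
      Finset.prod_nonneg fun ν _ => B9Eq319BlockTentLift.profile_nonneg (offset_lt L m b.1 ν)
    have hPle : ∏ ν ∈ Finset.univ.erase b.2, (((offset L m b.1 ν : ℕ) : ℝ) * ((L : ℝ) - 1 - (offset L m b.1 ν : ℕ))) ≤ ((L : ℝ) ^ 2 / 4) ^ (d - 1) := by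
      have h := Finset.prod_le_prod (s := Finset.univ.erase b.2) (fun ν _ => B9Eq319BlockTentLift.profile_nonneg (offset_lt L m b.1 ν))
        (fun ν _ => B9Eq319BlockTentLift.profile_le L (offset L m b.1 ν))
      rwa [Finset.prod_const, Finset.card_erase_of_mem (Finset.mem_univ b.2), Finset.card_univ, Fintype.card_fin] at h
    exact ⟨mul_nonneg hq0 hP0, mul_le_mul hqle hPle hP0 (by positivity)⟩
  have hpt : ∀ b : Bond d (fineP L m), c₀ * ‖WL2.equiv ℂ (fun _ : Bond d (fineP L m) => c₀) W
      ((WL2.equiv ℂ (fun _ : Bond d (fineP L m) => c₀) W).symm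
        (fun b => (((((offset L m b.1 b.2 : ℕ) : ℝ) ^ 2 * ((L : ℝ) - 1 - (offset L m b.1 b.2 : ℕ))) *
            ∏ ν ∈ Finset.univ.erase b.2, (((offset L m b.1 ν : ℕ) : ℝ) * ((L : ℝ) - 1 - (offset L m b.1 ν : ℕ))) : ℝ) : ℂ) •
          ψt (blockCoord L m b.1, b.2))) b‖ ^ 2 ≤ c₀ * (S ^ 2 * ‖ψt (blockCoord L m b.1, b.2)‖ ^ 2) := by
    intro b
    refine mul_le_mul_of_nonneg_left ?_ hc₀.le
    rw [Equiv.apply_symm_apply, norm_smul, Complex.norm_real, Real.norm_eq_abs, abs_of_nonneg (hcoef b).1, mul_pow]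
    exact mul_le_mul_of_nonneg_right (pow_le_pow_left₀ (hcoef b).1 (hcoef b).2 2) (sq_nonneg _)
  refine (Finset.sum_le_sum fun b _ => hpt b).trans (le_of_eq ?_)
  have hψ : ‖ψ‖ ^ 2 = c₁ * ∑ cc : Bond d m, ‖ψt cc‖ ^ 2 := by rw [WL2.norm_sq, Finset.mul_sum]
  rw [← Finset.mul_sum, ← Finset.mul_sum, B9Eq3126BondLiftEnergy.sum_norm_sq_blockCoord L m ψt, hψ]
  field_simp

end Size

/-! ## §3 Perturbing a test family: pairing and energy letters move by norms of differences times the size of the test field -/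

section Perturb

variable {E F : Type*} [NormedAddCommGroup E] [NormedAddCommGroup F] [InnerProductSpace ℂ F]

/-- **THE PAIRING LETTER UNDER A PERTURBATION OF `Q`**: `β‖ψ‖² ≤ re⟪Q₁u, ψ⟫`, `‖Q_Uu − Q₁u‖ ≤ δ‖u‖`, `‖u‖ ≤ N‖ψ‖` give
`(β − δN)‖ψ‖² ≤ re⟪Q_Uu, ψ⟫`. [folklore] [cite: Balaban1985BackgroundPropagators, (3.79) p.406, Thm 3.11 p.416] -/
theorem pairing_perturb {u : E} {ψ q₁ qU : F} {β δ N : ℝ} (hδ : 0 ≤ δ)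
    (hβ : β * ‖ψ‖ ^ 2 ≤ RCLike.re ⟪q₁, ψ⟫_ℂ) (hq : ‖qU - q₁‖ ≤ δ * ‖u‖) (hu : ‖u‖ ≤ N * ‖ψ‖) :
    (β - δ * N) * ‖ψ‖ ^ 2 ≤ RCLike.re ⟪qU, ψ⟫_ℂ := by
  have h1 : RCLike.re ⟪qU, ψ⟫_ℂ = RCLike.re ⟪q₁, ψ⟫_ℂ + RCLike.re ⟪qU - q₁, ψ⟫_ℂ := by
    rw [← map_add, ← inner_add_left, add_sub_cancel]
  have h2 : |RCLike.re ⟪qU - q₁, ψ⟫_ℂ| ≤ δ * ‖u‖ * ‖ψ‖ :=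
    (RCLike.abs_re_le_norm _).trans ((norm_inner_le_norm _ _).trans (mul_le_mul_of_nonneg_right hq (norm_nonneg _)))
  have h3 : δ * ‖u‖ * ‖ψ‖ ≤ δ * N * ‖ψ‖ ^ 2 := by
    rw [sq, ← mul_assoc]
    exact mul_le_mul_of_nonneg_right (by rw [mul_assoc]; exact mul_le_mul_of_nonneg_left hu hδ) (norm_nonneg _)
  rw [h1]
  nlinarith [neg_abs_le (RCLike.re ⟪qU - q₁, ψ⟫_ℂ)]

/-- **A SQUARED NORM UNDER A PERTURBATION**: `‖x_U‖² ≤ 2‖x₁‖² + 2‖x_U − x₁‖²`. [folklore] [cite: Balaban1985BackgroundPropagators, (3.70)–(3.73) pp.404–405] -/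
theorem norm_sq_le_two_mul {x₁ xU : E} : ‖xU‖ ^ 2 ≤ 2 * ‖x₁‖ ^ 2 + 2 * ‖xU - x₁‖ ^ 2 := by
  have h : ‖xU‖ ≤ ‖x₁‖ + ‖xU - x₁‖ := by
    have := norm_add_le x₁ (xU - x₁); rwa [add_sub_cancel] at this
  nlinarith [norm_nonneg xU, norm_nonneg x₁, norm_nonneg (xU - x₁), sq_nonneg (‖x₁‖ - ‖xU - x₁‖)]

end Perturb

end Literature.MathematicalPhysics.QuantumFieldTheory.Balaban1983to89.B9Eq3126KFloorWindowedKit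

end
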